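import Literature.NumberTheory.IwasawaTheory.NarrowFukudaRankPackage
import Literature.NumberTheory.IwasawaTheory.FukudaRankGrowthSteps
import Literature.NumberTheory.IwasawaTheory.ClassicalMuVanishesIffBoundedRank
import HarnessLib

/-!
# NARROW FUKUDA: Fukuda 1994, Theorem 1 (2) for the NARROW class groups of a `ℤ_p`-tower, proved at finite level —
# `rank_p Cl⁺(K_{n+1}) = rank_p Cl⁺(K_n)` for some `n ≥ n₀` ⟹ `rank_p Cl⁺(K_m) = rank_p Cl⁺(K_n)` for all `m ≥ n`;
# consequences: bounded narrow ranks, Iwasawa's `μ = 0`, and (at `p = 2`) a bounded narrow defect `ord₂ h⁺(K_m) − ord₂ h(K_m)`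

Topic `NumberTheory/IwasawaTheory` (namespace = path). THEOREM-ONLY file (no definition, no named fact, no `sorry`), written by the prover seat
`cruxlead-stmt-BirchSwinnertonDyer-19573-w2` GEN 9 (cell `bsd-2adic`; `--supports` stmt-BirchSwinnertonDyer-19573; closes nothing). Assembly of
«NARROW FUKUDA» from the package `NarrowFukudaRankPackage.exists_layer_package` and the (unchanged, abstract) rank step
`FukudaGroup.relIndex_commutator_sup_pow_eq_card_quotient` of `FukudaRankGrowthSteps` (seat `bsd-potss-k8t-c4` g20).

THE PRINT AND THE NARROW READING.  T. Fukuda, *Remarks on ℤ_p-extensions of number fields*, Proc. Japan Acad. 70 A (1994) p. 264, Thm. 1 (2):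
«If there exists an integer `n ≥ n₀` such that `rank(A_{n+1}) = rank(A_n)`, then `rank(A_m) = rank(A_n)` for all `m ≥ n`. In particular, we see that
`μ_p(K/k) = 0`.»  (`n₀`: every prime ramified in `K_∞/k` is totally ramified in `K_∞/k_{n₀}`; proof: `Y ⊂ pX` by Nakayama applied to
`Z = (Y + pX)/pX`, for `X = Gal(L/K_∞)`, `L` the maximal unramified abelian pro-`p` extension of `K_∞`.)  The proof uses of `L` only that
`L/K_∞` is abelian, unramified at the primes above `p` (so that the inertia groups inject into `Γ`), and that `Gal(L_n/k_n) ≅ A_n` by class field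
theory; it therefore applies VERBATIM to `L⁺` = the maximal abelian pro-`p` extension of `K_∞` unramified at all FINITE primes (ramification at the
real places allowed) and `A_n⁺` = the `p`-part of the NARROW class group `Cl⁺(k_n) ≅ Gal(K¹(k_n)/k_n)` (Neukirch VI (6.8)) — the object Greenberg
uses at `p = 2` over the totally real layers `ℚ_n` (LNM 1716 p. 122: «`L*_∞` … the maximal abelian pro-2 extension of `ℚ_∞` which is unramified at
all nonarchimedean primes»).  At finite level (tree idiom, no Iwasawa module): `NarrowFukudaRankPackage` + the rank step give
**`NarrowFukuda.index_range_pow_narrowClassGroup_eq_of_succ_eq`**.  The narrow `p`-rank of a layer is written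
`[Cl⁺(K_m) : Cl⁺(K_m)^p] = (powMonoidHom p).range.index` (`= p^{rank_p Cl⁺(K_m)}`, `NarrowClassGroupCounting.index_range_powMonoidHom_narrowClassGroup_eq_prime_pow`),
for ANY `NumberField` instance on the layer `κ.layer m` (the value does not depend on it).

CONSEQUENCES (all `p`; the last at `p = 2`), the reason this seat wants the theorem (Kida-lite, GEN 8): under the hypothesis of Thm. 1 (2)⁺,
* `exists_forall_padicValNat_index_le_of_succ_eq` — the narrow `p`-ranks `rank_p Cl⁺(K_m)` are BOUNDED along the tower;
* `classicalMuVanishes_of_narrow_succ_eq` — Iwasawa's `μ = 0` for `κ` (`rank_p Cl ≤ rank_p Cl⁺`, `index_range_pow_classGroup_dvd_narrowClassGroup`,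
  and the tree's «bounded ranks ⟹ `μ = 0`» `classicalMuVanishes_of_forall_classGroupPRank_le`);
* `exists_narrowDefect_le_of_succ_eq` (`p = 2`) — `ord₂ h⁺(K_m) ≤ ord₂ h(K_m) + D` for all `m` (`ord₂ (h⁺/h) ≤ rank₂ Cl⁺`,
  `padicValNat_two_narrowClassNumber_le`): hypotheses (a) ∧ (b) of `ClassicalMuVanishesQuadraticAscentNarrow{,Rat}` / `…AdjoinIOfNarrow`
  («narrow `μ₂ = 0`») from the FINITE certificate «two consecutive layers with the same narrow `2`-rank».

References: [Fukuda1994] Thm. 1 (2), p. 264; [Washington1997] §13.3 Lemmas 13.15/13.18, Prop. 13.22/13.23; [NeukirchANT1999] Ch. VI §6 Prop. (6.8);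
[GreenbergLNM1716] p. 122; [Kida1982JFields] (context: `μ₂` of `J`-fields via the narrow module of the maximal real subfield).
-/

noncomputable section

open scoped NumberField IsMulCommutative
open NumberField Field Finset

namespace Literature.NumberTheory.IwasawaTheory

open Literature.NumberTheory.EllipticCurves Literature.NumberTheory.NumberFields

variable {K : Type} [Field K] [NumberField K] {p : ℕ} [hp : Fact p.Prime]

/-! ## §1 Rank constancy at the top layer `K_{n+t}` -/

/-- **Thm. 1 (2)⁺ at top `K_{n+t}`** (`t ≥ 1`): `[Cl⁺(K_{n+1}) : Cl⁺(K_{n+1})^p] = [Cl⁺(K_n) : Cl⁺(K_n)^p] ⟹ [Cl⁺(K_{n+t}) : Cl⁺(K_{n+t})^p] = [Cl⁺(K_n) : Cl⁺(K_n)^p]`,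
from the narrow package and Fukuda's rank step (`Y₀ ⊆ pA` by Nakayama, then `[G_j : N_jP_j] = #(A/pA)` for every layer).
[cite: Fukuda1994, Thm. 1 (2), p. 264 (proof)] [cite: Washington1997, §13.3 Lemma 13.18 and Prop. 13.22] -/
theorem NarrowFukuda.index_range_pow_narrowClassGroup_add_eq (κ : ZpExtension K p) {n₀ n : ℕ} (hκ : TotallyRamifiedFrom κ n₀) (hn : n₀ ≤ n)
    (t : ℕ) (ht : 1 ≤ t) [NumberField (κ.layer n)] [NumberField (κ.layer (n + 1))] [NumberField (κ.layer (n + t))]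
    (hr : (powMonoidHom (α := NarrowClassGroup (κ.layer (n + 1))) p).range.index =
      (powMonoidHom (α := NarrowClassGroup (κ.layer n)) p).range.index) :
    (powMonoidHom (α := NarrowClassGroup (κ.layer (n + t))) p).range.index =
      (powMonoidHom (α := NarrowClassGroup (κ.layer n)) p).range.index := by
  classical
  obtain ⟨G, _instG, _instF, A', hA'n, _instC, g, 𝓘, hgA, hgen, hA'index, h𝓘, hg𝓘, hlayer⟩ :=
    NarrowFukuda.exists_layer_package κ hκ hn t ht
  haveI : NumberField (κ.layer (n + 0)) := ‹NumberField (κ.layer n)›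
  obtain ⟨G₀, hAG₀, hG₀, hr₀⟩ := hlayer 0 (Nat.zero_le t)
  obtain ⟨G₁, hAG₁, hG₁, hr₁⟩ := hlayer 1 ht
  obtain ⟨Gt, hAGt, hGt, hrt⟩ := hlayer t le_rfl
  have h01 : ((⁅G₀, G₀⁆ ⊔ ⨆ I ∈ 𝓘, I ⊓ G₀) ⊔ Subgroup.closure ((fun x : G => x ^ p) '' (G₀ : Set _))).relIndex G₀ =
      ((⁅G₁, G₁⁆ ⊔ ⨆ I ∈ 𝓘, I ⊓ G₁) ⊔ Subgroup.closure ((fun x : G => x ^ p) '' (G₁ : Set _))).relIndex G₁ := by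
    rw [hr₀, hr₁]
    exact hr.symm
  have hRt := FukudaGroup.relIndex_commutator_sup_pow_eq_card_quotient hgA hgen hA'index h𝓘 hg𝓘 ht hAG₀ hG₀ hAG₁ hG₁ h01 le_rfl hAGt hGt
  have hR0 := FukudaGroup.relIndex_commutator_sup_pow_eq_card_quotient hgA hgen hA'index h𝓘 hg𝓘 ht hAG₀ hG₀ hAG₁ hG₁ h01
    (Nat.zero_le t) hAG₀ hG₀
  rw [hrt] at hRt
  rw [hr₀] at hR0
  exact hRt.trans hR0.symm

/-! ## §2 Narrow Fukuda, Theorem 1 (2)⁺ -/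

/-- **NARROW FUKUDA (Fukuda 1994, Thm. 1 (2), for narrow class groups).** Let `κ` be a `ℤ_p`-extension of a number field `K` with Fukuda index
`n₀` (`TotallyRamifiedFrom κ n₀`: every prime ramified in `K_∞/K` is totally ramified in `K_∞/K_{n₀}`), and `n ≥ n₀` with
`rank_p Cl⁺(K_{n+1}) = rank_p Cl⁺(K_n)` (stated as `[Cl⁺(K_{n+1}) : Cl⁺(K_{n+1})^p] = [Cl⁺(K_n) : Cl⁺(K_n)^p]`). Then
`rank_p Cl⁺(K_m) = rank_p Cl⁺(K_n)` for every `m ≥ n`.  The printed theorem is the same statement for the (wide) class groups; its proof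
(Nakayama over `Λ` for `Z = (Y + pX)/pX`) applies verbatim to the maximal abelian pro-`p` extension of `K_∞` unramified at the finite primes, and is
carried out here at finite level. [cite: Fukuda1994, Thm. 1 (2), p. 264] [cite: Washington1997, §13.3 Prop. 13.22] [cite: NeukirchANT1999, Ch. VI §6 Prop. (6.8)]
[cite: GreenbergLNM1716, §5, proof of Prop. 5.14 (p. 122)] -/
theorem NarrowFukuda.index_range_pow_narrowClassGroup_eq_of_succ_eq (κ : ZpExtension K p) {n₀ n : ℕ}
    (hκ : TotallyRamifiedFrom κ n₀) (hn : n₀ ≤ n) [NumberField (κ.layer n)] [NumberField (κ.layer (n + 1))]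
    (hr : (powMonoidHom (α := NarrowClassGroup (κ.layer (n + 1))) p).range.index =
      (powMonoidHom (α := NarrowClassGroup (κ.layer n)) p).range.index)
    {m : ℕ} (hm : n ≤ m) [NumberField (κ.layer m)] :
    (powMonoidHom (α := NarrowClassGroup (κ.layer m)) p).range.index =
      (powMonoidHom (α := NarrowClassGroup (κ.layer n)) p).range.index := by
  obtain ⟨t, rfl⟩ := Nat.exists_eq_add_of_le hm
  rcases Nat.eq_zero_or_pos t with rfl | ht
  · rfl
  · exact NarrowFukuda.index_range_pow_narrowClassGroup_add_eq κ hκ hn t ht hr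

/-! ## §3 Consequences: bounded narrow ranks, `μ = 0`, bounded narrow defect (`p = 2`) -/

/-- **Bounded narrow `p`-ranks.** Under the hypothesis of Thm. 1 (2)⁺ there is `B` with `ord_p [Cl⁺(K_m) : Cl⁺(K_m)^p] ≤ B` for ALL `m`
(for `m ≥ n` the rank is that of `K_n`; finitely many layers below). [cite: Fukuda1994, Thm. 1 (2), p. 264] -/
theorem NarrowFukuda.exists_forall_padicValNat_index_le_of_succ_eq (κ : ZpExtension K p) {n₀ n : ℕ}
    (hκ : TotallyRamifiedFrom κ n₀) (hn : n₀ ≤ n) [NumberField (κ.layer n)] [NumberField (κ.layer (n + 1))]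
    (hr : (powMonoidHom (α := NarrowClassGroup (κ.layer (n + 1))) p).range.index =
      (powMonoidHom (α := NarrowClassGroup (κ.layer n)) p).range.index) :
    ∃ B : ℕ, ∀ m : ℕ, ∀ [NumberField (κ.layer m)],
      padicValNat p (powMonoidHom (α := NarrowClassGroup (κ.layer m)) p).range.index ≤ B := by
  classical
  -- a uniform choice of the narrow rank of each layer (any `NumberField` instance gives the same number)
  have hinst : ∀ m : ℕ, NumberField (κ.layer m) := fun m =>
    haveI : FiniteDimensional K (κ.layer m) := κ.finiteDimensional_layer_holds m
    NumberField.of_module_finite K _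
  let f : ℕ → ℕ := fun m => by
    haveI := hinst m
    exact padicValNat p (powMonoidHom (α := NarrowClassGroup (κ.layer m)) p).range.index
  refine ⟨(Finset.range (n + 1)).sup f, fun m _ => ?_⟩
  rcases le_or_gt m n with hmn | hmn
  · have hfm : padicValNat p (powMonoidHom (α := NarrowClassGroup (κ.layer m)) p).range.index = f m := rfl
    rw [hfm]
    exact Finset.le_sup (f := f) (Finset.mem_range.mpr (Nat.lt_succ_of_le hmn))
  · rw [NarrowFukuda.index_range_pow_narrowClassGroup_eq_of_succ_eq κ hκ hn hr hmn.le]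
    have hfn : padicValNat p (powMonoidHom (α := NarrowClassGroup (κ.layer n)) p).range.index = f n := rfl
    rw [hfn]
    exact Finset.le_sup (f := f) (Finset.mem_range.mpr (Nat.lt_succ_self n))

/-- **Iwasawa's `μ = 0` from the narrow certificate** (the printed rider «in particular `μ_p(K/k) = 0`», narrow form): under the hypothesis of
Thm. 1 (2)⁺ the narrow `p`-ranks are bounded, hence so are the `p`-ranks of the class groups (`[Cl : Cl^p] ∣ [Cl⁺ : (Cl⁺)^p]`), hence `μ = 0` in
growth form (`classicalMuVanishes_of_forall_classGroupPRank_le`). [cite: Fukuda1994, Thm. 1 (2), p. 264] [cite: Washington1997, §13.3 Prop. 13.23] -/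
theorem NarrowFukuda.classicalMuVanishes_of_succ_eq (κ : ZpExtension K p) {n₀ n : ℕ}
    (hκ : TotallyRamifiedFrom κ n₀) (hn : n₀ ≤ n) [NumberField (κ.layer n)] [NumberField (κ.layer (n + 1))]
    (hr : (powMonoidHom (α := NarrowClassGroup (κ.layer (n + 1))) p).range.index =
      (powMonoidHom (α := NarrowClassGroup (κ.layer n)) p).range.index) :
    ClassicalMuVanishes κ := by
  classical
  obtain ⟨B, hB⟩ := NarrowFukuda.exists_forall_padicValNat_index_le_of_succ_eq κ hκ hn hr
  refine classicalMuVanishes_of_forall_classGroupPRank_le κ (B := B) fun m => ?_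
  haveI : FiniteDimensional K (κ.layer m) := κ.finiteDimensional_layer_holds m
  haveI : NumberField (κ.layer m) := NumberField.of_module_finite K _
  haveI : Finite (NarrowClassGroup (κ.layer m)) := Literature.NumberTheory.GaloisRepresentations.finite_rayClassGroup top_ne_bot
  have hidx0 : (powMonoidHom (α := NarrowClassGroup (κ.layer m)) p).range.index ≠ 0 := Subgroup.index_ne_zero_of_finite
  refine le_trans ?_ (hB m)
  rw [classGroupPRank_def, ← Subgroup.index_eq_card]
  exact (padicValNat_dvd_iff_le hidx0).mp
    (pow_padicValNat_dvd.trans (index_range_pow_classGroup_dvd_narrowClassGroup (K := ↥(κ.layer m)) p))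

/-- **Bounded narrow defect at `p = 2`.** For a `ℤ₂`-extension `κ` with Fukuda index `n₀ ≤ n` and `rank₂ Cl⁺(K_{n+1}) = rank₂ Cl⁺(K_n)` there is
`D` with `ord₂ h⁺(K_m) ≤ ord₂ h(K_m) + D` for ALL `m` (`ord₂ (h⁺/h) ≤ rank₂ Cl⁺`, `padicValNat_two_narrowClassNumber_le`, and the bounded narrow
ranks) — hypothesis (b) of the Kida-lite ascent (`ClassicalMuVanishesQuadraticAscentNarrow`). [cite: Fukuda1994, Thm. 1 (2), p. 264]
[cite: FrohlichTaylor1990, Ch. V §1 (1.8)–(1.13), pp. 163–164] -/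
theorem NarrowFukuda.exists_narrowDefect_le_of_succ_eq (κ : ZpExtension K 2) {n₀ n : ℕ}
    (hκ : TotallyRamifiedFrom κ n₀) (hn : n₀ ≤ n) [NumberField (κ.layer n)] [NumberField (κ.layer (n + 1))]
    (hr : (powMonoidHom (α := NarrowClassGroup (κ.layer (n + 1))) 2).range.index =
      (powMonoidHom (α := NarrowClassGroup (κ.layer n)) 2).range.index) :
    ∃ D : ℕ, ∀ m : ℕ, ∀ [NumberField (κ.layer m)],
      padicValNat 2 (narrowClassNumber (κ.layer m)) ≤ padicValNat 2 (classNumber (κ.layer m)) + D := by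
  haveI : Fact (Nat.Prime 2) := ⟨Nat.prime_two⟩
  obtain ⟨B, hB⟩ := NarrowFukuda.exists_forall_padicValNat_index_le_of_succ_eq κ hκ hn hr
  refine ⟨B, fun m _ => ?_⟩
  exact (padicValNat_two_narrowClassNumber_le (K := ↥(κ.layer m))).trans (Nat.add_le_add_left (hB m) _)

/-- **The narrow certificate, packaged for Kida-lite** (`p = 2`): Fukuda index `n₀ ≤ n` and `rank₂ Cl⁺(K_{n+1}) = rank₂ Cl⁺(K_n)` give BOTH
(a) Iwasawa's `μ₂ = 0` for `κ` and (b) a bounded narrow defect `ord₂ h⁺(K_m) − ord₂ h(K_m) ≤ D` — the two hypotheses under which GEN 8's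
`classicalMuVanishes_restrict_of_quadratic_of_narrowDefect_le` / `classicalMu_sup_adjoin_of_sq_eq_neg_one_of_narrowDefect_le` ascend `μ₂ = 0` to a
totally complex quadratic extension. [cite: Fukuda1994, Thm. 1 (2), p. 264] [cite: Kida1982JFields, main theorem (μ-part; shape only)] -/
theorem NarrowFukuda.classicalMuVanishes_and_exists_narrowDefect_le_of_succ_eq (κ : ZpExtension K 2) {n₀ n : ℕ}
    (hκ : TotallyRamifiedFrom κ n₀) (hn : n₀ ≤ n) [NumberField (κ.layer n)] [NumberField (κ.layer (n + 1))]
    (hr : (powMonoidHom (α := NarrowClassGroup (κ.layer (n + 1))) 2).range.index =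
      (powMonoidHom (α := NarrowClassGroup (κ.layer n)) 2).range.index) :
    ClassicalMuVanishes κ ∧ ∃ D : ℕ, ∀ m : ℕ, ∀ [NumberField (κ.layer m)],
      padicValNat 2 (narrowClassNumber (κ.layer m)) ≤ padicValNat 2 (classNumber (κ.layer m)) + D :=
  haveI : Fact (Nat.Prime 2) := ⟨Nat.prime_two⟩
  ⟨NarrowFukuda.classicalMuVanishes_of_succ_eq κ hκ hn hr, NarrowFukuda.exists_narrowDefect_le_of_succ_eq κ hκ hn hr⟩

/-! ## §4 The narrow rank CERTIFICATE of a number field (all cyclotomic `ℤ₂`-extensions at once) -/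

/-- **Explicit bound.** Under the hypothesis of Thm. 1 (2)⁺ at `n`, a bound `B` for the narrow `p`-ranks of the layers `K_m`, `m ≤ n`, bounds the
narrow `p`-rank of EVERY layer. [cite: Fukuda1994, Thm. 1 (2), p. 264] -/
theorem NarrowFukuda.forall_padicValNat_index_le_of_succ_eq (κ : ZpExtension K p) {n₀ n : ℕ}
    (hκ : TotallyRamifiedFrom κ n₀) (hn : n₀ ≤ n) [NumberField (κ.layer n)] [NumberField (κ.layer (n + 1))]
    (hr : (powMonoidHom (α := NarrowClassGroup (κ.layer (n + 1))) p).range.index =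
      (powMonoidHom (α := NarrowClassGroup (κ.layer n)) p).range.index) {B : ℕ}
    (hB : ∀ m : ℕ, m ≤ n → ∀ [NumberField (κ.layer m)],
      padicValNat p (powMonoidHom (α := NarrowClassGroup (κ.layer m)) p).range.index ≤ B)
    (m : ℕ) [NumberField (κ.layer m)] :
    padicValNat p (powMonoidHom (α := NarrowClassGroup (κ.layer m)) p).range.index ≤ B := by
  rcases le_or_gt m n with hmn | hmn
  · exact hB m hmn
  · rw [NarrowFukuda.index_range_pow_narrowClassGroup_eq_of_succ_eq κ hκ hn hr hmn.le]
    exact hB n le_rfl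

/-- **THE NARROW RANK CERTIFICATE ⟹ «narrow `μ₂ = 0`» (hypotheses (a) ∧ (b) of Kida-lite), for every cyclotomic `ℤ₂`-extension of a number
field `F` at once.**  DATA: an index `n₀` and a bound `B` such that for every cyclotomic `ℤ₂`-extension `κ` of `F` (they all have the same layers
`F_m = F·ℚ_m`): (i) `κ` has Fukuda index `n₀` (every prime above `2` ramified in `F_∞/F` is totally ramified in `F_∞/F_{n₀}`); (ii)
`rank₂ Cl⁺(F_{n₀+1}) = rank₂ Cl⁺(F_{n₀})` (as `[Cl⁺ : (Cl⁺)²]`-indices); (iii) `rank₂ Cl⁺(F_m) ≤ B` for `m ≤ n₀`.  CONCLUSION: (a) Iwasawa's `μ₂ = 0`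
for every cyclotomic `κ`, and (b) `ord₂ h⁺(F_m) ≤ ord₂ h(F_m) + B` for every cyclotomic `κ` and every layer — exactly the inputs `hμ`, `D := B`,
`hδ` of `classicalMu_sup_adjoin_of_sq_eq_neg_one_of_narrowDefect_le` (GEN 8).  For a cubic `F` with `n₀ = 0` the data are the narrow `2`-ranks
of `F` and of `F(√2)` (two finite class-group computations), replacing the `∀ n` hypothesis (b).
[cite: Fukuda1994, Thm. 1 (2), p. 264] [cite: Kida1982JFields, main theorem (μ-part; shape only)] [cite: GreenbergLNM1716, §5, proof of Prop. 5.14 (p. 122)] -/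
theorem NarrowFukuda.narrowMu_of_narrowRankCertificate (F : Type) [Field F] [NumberField F] (n₀ B : ℕ)
    (hcert : ∀ κ : ZpExtension F 2, κ.IsCyclotomic →
      TotallyRamifiedFrom κ n₀ ∧
      (∀ [NumberField (κ.layer n₀)] [NumberField (κ.layer (n₀ + 1))],
        (powMonoidHom (α := NarrowClassGroup (κ.layer (n₀ + 1))) 2).range.index =
          (powMonoidHom (α := NarrowClassGroup (κ.layer n₀)) 2).range.index) ∧
      (∀ m : ℕ, m ≤ n₀ → ∀ [NumberField (κ.layer m)],
        padicValNat 2 (powMonoidHom (α := NarrowClassGroup (κ.layer m)) 2).range.index ≤ B)) :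
    (∀ κ : ZpExtension F 2, κ.IsCyclotomic → ClassicalMuVanishes κ) ∧
    (∀ κ : ZpExtension F 2, κ.IsCyclotomic → ∀ m : ℕ, ∀ [NumberField (κ.layer m)],
      padicValNat 2 (narrowClassNumber (κ.layer m)) ≤ padicValNat 2 (classNumber (κ.layer m)) + B) := by
  haveI : Fact (Nat.Prime 2) := ⟨Nat.prime_two⟩
  have key : ∀ κ : ZpExtension F 2, κ.IsCyclotomic → ClassicalMuVanishes κ ∧ ∀ m : ℕ, ∀ [NumberField (κ.layer m)],
      padicValNat 2 (narrowClassNumber (κ.layer m)) ≤ padicValNat 2 (classNumber (κ.layer m)) + B := by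
    intro κ hκc
    obtain ⟨hκ, hr, hB⟩ := hcert κ hκc
    haveI : FiniteDimensional F (κ.layer n₀) := κ.finiteDimensional_layer_holds n₀
    haveI : FiniteDimensional F (κ.layer (n₀ + 1)) := κ.finiteDimensional_layer_holds (n₀ + 1)
    haveI : NumberField (κ.layer n₀) := NumberField.of_module_finite F _
    haveI : NumberField (κ.layer (n₀ + 1)) := NumberField.of_module_finite F _
    have hr' := hr
    refine ⟨NarrowFukuda.classicalMuVanishes_of_succ_eq κ hκ le_rfl hr', fun m _ => ?_⟩
    exact (padicValNat_two_narrowClassNumber_le (K := ↥(κ.layer m))).trans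
      (Nat.add_le_add_left (NarrowFukuda.forall_padicValNat_index_le_of_succ_eq κ hκ le_rfl hr' hB m) _)
  exact ⟨fun κ hκc => (key κ hκc).1, fun κ hκc => (key κ hκc).2⟩

end Literature.NumberTheory.IwasawaTheory

end
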